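import Literature.NumberTheory.Sieve.ChenTwinUpperBCardTools
import Literature.NumberTheory.Sieve.ChenLowerSieveNumerics
import Literature.NumberTheory.Sieve.ChenSwitchingConstantTenth
import HarnessLib

/-!
# Chen's Theorem I: the numerical inequality `a − b/2 − c/2 > 0.67 e^γ/20`

Companion of `ChenTheoremIAssembly.lean`: `Literature.NumberTheory.Sieve.Chen.Chen1973_theoremI_of`
derives Chen's Theorem I (`P_x(1,2) ≥ 0.67 x C_x/(log x)²`, Sci. Sinica 16 (1973)) from three sieve
estimates at the sieving level `z = x^{1/10}` with constants `a, b, c` subject to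
`a − b/2 − c/2 > 0.67 e^γ/20`. The constants produced by the tree are

* `a = f(5)` (`lowerSieveFun 1 5`; `ChenTheoremISiftedLower.siftedCount_tenth_lower`), with
  `5 f(5) = 2e^γ (log 4 + ∫_3^4 J(u − 1) du/u)` (`five_mul_lowerSieveFun_one`, Chen's (30)–(31));
* `b = ∫_{1/10}^{1/3} F(5 − 10β) dβ/β` (`F = upperSieveFun 1`;
  `ChenTheoremISiftedDvdUpper.siftedCountDvd_tenth_sum_upper`);
* `c = (2e^γ/5) c'`, `c' = ∫_{1/10}^{1/3} log(2 − 3α) dα/(α(1 − α))` (`switchingConstantTenth`; the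
  switching term at Chen's parameters).

This file PROVES the inequality for these constants (`chen_theoremI_mainInequality`), i.e. Chen's
§III "`2.6408 − 1.9702 ≥ 0.67`" with the exact sieve functions:

* `integral_upperSieveFun_tenth_eq` — `b = (2e^γ/5)(log 8 + 5 ∫_3^4 J(u − 1) du/(u(5 − u)))`
  (substitute `u = 5 − 10β`: `b = ∫_{5/3}^4 F(u) du/(5 − u)`, then `F(u) = 2e^γ/u` on `[5/3, 3]`,
  `F(u) = 2e^γ(1 + J(u−1))/u` on `[3, 4]` (`LinearSieveSecondRange`) and `∫ du/(u(5−u)) = log(u/(5−u))/5`);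
  this is Chen's (32) (`4 log 8 + 2I₂` in units `x C_x/(log x)²`, `I₂ = ∫_3^4 10 J(u−1) du/(u(5−u))`);
* hence `a − b/2 = (e^γ/5)(log 2 + 2 ∫_3^4 ((5/2 − u)/(u(5 − u))) J(u − 1) du)` (Chen's combination (33)),
  and with `∫_3^4 ((5/2 − u)/(u(5 − u))) J(u − 1) du ≥ ½ + 3 log 3 − (11/2) log 2`
  (`chen_lowerSieveIntegral_ge`, Chen's "`≥ −0.0164725`") and `c' < 0.4911`
  (`switchingConstantTenth_lt`, Chen's "`≤ 0.49254`"):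
  `a − b/2 − c/2 ≥ (e^γ/5)(1 + 6 log 3 − 10 log 2 − 0.4911) > (e^γ/5) · 0.1675 = 0.67 e^γ/20`
  (`1 + 6 log 3 − 10 log 2 − 0.4911 = 0.16910…`; in Chen's normalisation `× 20e^{−γ}`:
  `4 log 2 + 8(I₁ − ¼I₂) − 4c' ≥ 0.676 > 0.67`, cf. `chen_mainConstant_gt`).

Everything here is proved; no definitions, no named facts.

## References

* Chen Jing-run, Sci. Sinica 16 (1973) 157–176, Lemma 8 (28), Lemma 9 (30)–(33), §III (PDF
  pp. 166–168 of the held copy). [ChenSciSinica1973]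
-/

open Real Set MeasureTheory intervalIntegral

noncomputable section

namespace Literature.NumberTheory.Sieve.Chen

/-! ### The integral `b = ∫_{1/10}^{1/3} F(5 − 10β) dβ/β` in closed form

The elementary integral `∫_a^b du/(u(5 − u)) = (log(b/(5−b)) − log(a/(5−a)))/5` used below is
`integral_inv_mul_sub_eq` (with `c = 5`) from `ChenTwinUpperBCardTools`. -/

/-- The substitution `u = 5 − 10β`: `∫_{1/10}^{1/3} F(5 − 10β) dβ/β = ∫_{5/3}^4 F(u) du/(5 − u)`.
[folklore] -/
theorem integral_upperSieveFun_tenth_subst :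
    ∫ β in (1 / 10 : ℝ)..(1 / 3), upperSieveFun 1 (5 - 10 * β) / β =
      ∫ u in (5 / 3 : ℝ)..4, upperSieveFun 1 u / (5 - u) := by
  have h1 : (fun β : ℝ => upperSieveFun 1 (5 - 10 * β) / β) =
      fun β => (fun u : ℝ => 10 * (upperSieveFun 1 u / (5 - u))) (5 - 10 * β) := by
    funext β
    simp only
    rw [show (5 : ℝ) - (5 - 10 * β) = 10 * β by ring]
    by_cases hβ : β = 0
    · simp [hβ]
    · field_simp
  rw [h1, intervalIntegral.integral_comp_sub_mul (fun u : ℝ => 10 * (upperSieveFun 1 u / (5 - u)))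
    (by norm_num : (10 : ℝ) ≠ 0) 5, intervalIntegral.integral_const_mul]
  norm_num
  ring

/-- On `[5/3, 3]`: `F(u)/(5 − u) = 2e^γ/(u(5 − u))`, whose integral is `(2e^γ/5) log 3`.
[cite: ChenSciSinica1973, Lemma 9 (32)] -/
theorem integral_upperSieveFun_first_range :
    ∫ u in (5 / 3 : ℝ)..3, upperSieveFun 1 u / (5 - u) =
      2 * Real.exp Real.eulerMascheroniConstant / 5 * Real.log 3 := by
  set A : ℝ := 2 * Real.exp Real.eulerMascheroniConstant with hA
  have hcongr : EqOn (fun u : ℝ => upperSieveFun 1 u / (5 - u)) (fun u => A * (1 / (u * (5 - u))))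
      (uIcc (5 / 3 : ℝ) 3) := by
    intro u hu
    rw [uIcc_of_le (by norm_num)] at hu
    have hu0 : 0 < u := by linarith [hu.1]
    have hu5 : 0 < 5 - u := by linarith [hu.2]
    simp only
    rw [upperSieveFun_one_eq_holds (s := u) ⟨hu0, hu.2⟩, hA]
    field_simp
  rw [intervalIntegral.integral_congr hcongr, intervalIntegral.integral_const_mul,
    integral_inv_mul_sub_eq (by norm_num) (by norm_num) (by norm_num)]
  have h1 : Real.log ((3 : ℝ) / (5 - 3)) - Real.log ((5 / 3 : ℝ) / (5 - 5 / 3)) = Real.log 3 := by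
    rw [← Real.log_div (by norm_num) (by norm_num)]
    norm_num
  rw [h1]
  ring

/-- On `[3, 4]`: `F(u)/(5 − u) = 2e^γ(1 + J(u − 1))/(u(5 − u))`, whose integral is
`(2e^γ/5) log(8/3) + 2e^γ ∫_3^4 J(u − 1) du/(u(5 − u))`. [cite: ChenSciSinica1973, Lemma 9 (32)] -/
theorem integral_upperSieveFun_second_range :
    ∫ u in (3 : ℝ)..4, upperSieveFun 1 u / (5 - u) =
      2 * Real.exp Real.eulerMascheroniConstant / 5 * Real.log (8 / 3) +
        2 * Real.exp Real.eulerMascheroniConstant *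
          ∫ u in (3 : ℝ)..4, linearSieveJ (u - 1) / (u * (5 - u)) := by
  set A : ℝ := 2 * Real.exp Real.eulerMascheroniConstant with hA
  have hcongr : EqOn (fun u : ℝ => upperSieveFun 1 u / (5 - u))
      (fun u => A * (1 / (u * (5 - u))) + A * (linearSieveJ (u - 1) / (u * (5 - u))))
      (uIcc (3 : ℝ) 4) := by
    intro u hu
    rw [uIcc_of_le (by norm_num)] at hu
    have hu0 : 0 < u := by linarith [hu.1]
    have hu5 : 0 < 5 - u := by linarith [hu.2]
    simp only
    rw [upperSieveFun_one_eq_of_mem_Icc ⟨hu.1, by linarith [hu.2]⟩, hA]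
    field_simp
  have hc1 : ContinuousOn (fun u : ℝ => 1 / (u * (5 - u))) (Icc (3 : ℝ) 4) := by
    refine continuousOn_const.div (continuousOn_id.mul (continuousOn_const.sub continuousOn_id))
      fun u hu => ?_
    have hu0 : 0 < u := by linarith [hu.1]
    have hu5 : 0 < 5 - u := by linarith [hu.2]
    exact (mul_pos hu0 hu5).ne'
  have hc2 : ContinuousOn (fun u : ℝ => linearSieveJ (u - 1) / (u * (5 - u))) (Icc (3 : ℝ) 4) := by
    refine ContinuousOn.div ?_ (continuousOn_id.mul (continuousOn_const.sub continuousOn_id))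
      fun u hu => ?_
    · exact continuousOn_linearSieveJ.comp (continuousOn_id.sub continuousOn_const) fun t ht => by
        show t - 1 ∈ Ioi 1
        rw [mem_Ioi]
        linarith [ht.1]
    · have hu0 : 0 < u := by linarith [hu.1]
      have hu5 : 0 < 5 - u := by linarith [hu.2]
      exact (mul_pos hu0 hu5).ne'
  have hi1 : IntervalIntegrable (fun u : ℝ => A * (1 / (u * (5 - u)))) volume (3 : ℝ) 4 :=
    (continuousOn_const.mul hc1).intervalIntegrable_of_Icc (by norm_num)
  have hi2 : IntervalIntegrable (fun u : ℝ => A * (linearSieveJ (u - 1) / (u * (5 - u)))) volume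
      (3 : ℝ) 4 :=
    (continuousOn_const.mul hc2).intervalIntegrable_of_Icc (by norm_num)
  rw [intervalIntegral.integral_congr hcongr, intervalIntegral.integral_add hi1 hi2,
    intervalIntegral.integral_const_mul, intervalIntegral.integral_const_mul,
    integral_inv_mul_sub_eq (by norm_num) (by norm_num) (by norm_num)]
  have h1 : Real.log ((4 : ℝ) / (5 - 4)) - Real.log ((3 : ℝ) / (5 - 3)) = Real.log (8 / 3) := by
    rw [← Real.log_div (by norm_num) (by norm_num)]
    norm_num
  rw [h1]
  ring

/-- **`b` in closed form** (Chen's (32)): `∫_{1/10}^{1/3} F(5 − 10β) dβ/β =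
(2e^γ/5)(log 8 + 5 ∫_3^4 J(u − 1) du/(u(5 − u)))`. [cite: ChenSciSinica1973, Lemma 9 (32)] -/
theorem integral_upperSieveFun_tenth_eq :
    ∫ β in (1 / 10 : ℝ)..(1 / 3), upperSieveFun 1 (5 - 10 * β) / β =
      2 * Real.exp Real.eulerMascheroniConstant / 5 *
        (Real.log 8 + 5 * ∫ u in (3 : ℝ)..4, linearSieveJ (u - 1) / (u * (5 - u))) := by
  rw [integral_upperSieveFun_tenth_subst]
  have hcont : ContinuousOn (fun u : ℝ => upperSieveFun 1 u / (5 - u)) (Icc (5 / 3 : ℝ) 4) := by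
    refine ContinuousOn.div ?_ (continuousOn_const.sub continuousOn_id) fun u hu => ?_
    · exact isBetaSieveSolution_upperSieveFun_one.continuousOn_upper.mono fun u hu =>
        show (0 : ℝ) < u by linarith [hu.1]
    · exact ne_of_gt (show (0 : ℝ) < 5 - u by linarith [hu.2])
  have hi1 : IntervalIntegrable (fun u : ℝ => upperSieveFun 1 u / (5 - u)) volume (5 / 3 : ℝ) 3 :=
    (hcont.mono (Icc_subset_Icc le_rfl (by norm_num))).intervalIntegrable_of_Icc (by norm_num)
  have hi2 : IntervalIntegrable (fun u : ℝ => upperSieveFun 1 u / (5 - u)) volume (3 : ℝ) 4 :=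
    (hcont.mono (Icc_subset_Icc (by norm_num) le_rfl)).intervalIntegrable_of_Icc (by norm_num)
  rw [← intervalIntegral.integral_add_adjacent_intervals hi1 hi2, integral_upperSieveFun_first_range,
    integral_upperSieveFun_second_range]
  have h8 : Real.log (8 : ℝ) = Real.log 3 + Real.log (8 / 3) := by
    rw [← Real.log_mul (by norm_num) (by norm_num)]
    norm_num
  rw [h8]
  ring

/-! ### `a − b/2` and the final inequality -/

/-- **`a − b/2` through Chen's combined integral (33)**:
`f(5) − b/2 = (e^γ/5)(log 2 + 2 ∫_3^4 ((5/2 − u)/(u(5 − u))) J(u − 1) du)`.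
[cite: ChenSciSinica1973, Lemma 9 (31)–(33)] -/
theorem lowerSieveFun_five_sub_half_integral :
    lowerSieveFun 1 5 - (∫ β in (1 / 10 : ℝ)..(1 / 3), upperSieveFun 1 (5 - 10 * β) / β) / 2 =
      Real.exp Real.eulerMascheroniConstant / 5 *
        (Real.log 2 + 2 * ∫ u in (3 : ℝ)..4, (5 / 2 - u) / (u * (5 - u)) * linearSieveJ (u - 1)) := by
  have hf : lowerSieveFun 1 5 = 2 * Real.exp Real.eulerMascheroniConstant / 5 *
      (Real.log 4 + ∫ u in (3 : ℝ)..4, linearSieveJ (u - 1) / u) := by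
    have h := five_mul_lowerSieveFun_one
    linear_combination (1 / 5 : ℝ) * h
  rw [hf, integral_upperSieveFun_tenth_eq]
  -- combine the two `J`-integrals
  have hJc : ContinuousOn (fun u : ℝ => linearSieveJ (u - 1)) (Icc (3 : ℝ) 4) :=
    continuousOn_linearSieveJ.comp (continuousOn_id.sub continuousOn_const) fun t ht => by
      show t - 1 ∈ Ioi 1
      rw [mem_Ioi]
      linarith [ht.1]
  have hne : ∀ u ∈ Icc (3 : ℝ) 4, u * (5 - u) ≠ 0 := fun u hu => by
    have hu0 : 0 < u := by linarith [hu.1]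
    have hu5 : 0 < 5 - u := by linarith [hu.2]
    exact (mul_pos hu0 hu5).ne'
  have hi1 : IntervalIntegrable (fun u : ℝ => linearSieveJ (u - 1) / u) volume (3 : ℝ) 4 :=
    (hJc.div continuousOn_id fun u hu => ne_of_gt (show (0 : ℝ) < u by linarith [hu.1]))
      |>.intervalIntegrable_of_Icc (by norm_num)
  have hi2 : IntervalIntegrable (fun u : ℝ => linearSieveJ (u - 1) / (u * (5 - u))) volume (3 : ℝ) 4 :=
    (hJc.div (continuousOn_id.mul (continuousOn_const.sub continuousOn_id)) hne)
      |>.intervalIntegrable_of_Icc (by norm_num)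
  have hcomb : (∫ u in (3 : ℝ)..4, linearSieveJ (u - 1) / u) -
      5 / 2 * (∫ u in (3 : ℝ)..4, linearSieveJ (u - 1) / (u * (5 - u))) =
      ∫ u in (3 : ℝ)..4, (5 / 2 - u) / (u * (5 - u)) * linearSieveJ (u - 1) := by
    rw [← intervalIntegral.integral_const_mul, ← intervalIntegral.integral_sub hi1 (hi2.const_mul _)]
    refine intervalIntegral.integral_congr fun u hu => ?_
    rw [uIcc_of_le (by norm_num)] at hu
    have hu0 : (u : ℝ) ≠ 0 := ne_of_gt (by linarith [hu.1])
    have hu5 : (5 : ℝ) - u ≠ 0 := ne_of_gt (by linarith [hu.2])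
    field_simp
    ring
  have h4 : Real.log (4 : ℝ) = 2 * Real.log 2 := by
    rw [show (4 : ℝ) = 2 ^ 2 by norm_num, Real.log_pow]; norm_num
  have h8 : Real.log (8 : ℝ) = 3 * Real.log 2 := by
    rw [show (8 : ℝ) = 2 ^ 3 by norm_num, Real.log_pow]; norm_num
  rw [← hcomb, h4, h8]
  ring

/-- **The numerical inequality of Chen's Theorem I** (hypothesis `habc` of `Chen1973_theoremI_of`
with the tree's constants): `0.67 e^γ/20 < f(5) − b/2 − c/2`, `b = ∫_{1/10}^{1/3} F(5 − 10β) dβ/β`,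
`c = (2e^γ/5) ∫_{1/10}^{1/3} log(2 − 3α) dα/(α(1 − α))` (Chen §III: `2.6408 − 1.9702 ≥ 0.67`; here
`f(5) − b/2 − c/2 ≥ (e^γ/5)(1 + 6 log 3 − 10 log 2 − 0.4911) > 0.67 e^γ/20`).
[cite: ChenSciSinica1973, §III (proof of Theorem I)] -/
theorem chen_theoremI_mainInequality :
    0.67 * Real.exp Real.eulerMascheroniConstant / 20 <
      lowerSieveFun 1 5 - (∫ β in (1 / 10 : ℝ)..(1 / 3), upperSieveFun 1 (5 - 10 * β) / β) / 2 -
        (2 * Real.exp Real.eulerMascheroniConstant / 5 * switchingConstantTenth) / 2 := by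
  rw [lowerSieveFun_five_sub_half_integral]
  have hG : 0 < Real.exp Real.eulerMascheroniConstant := Real.exp_pos _
  have hI := chen_lowerSieveIntegral_ge
  have hc := switchingConstantTenth_lt
  have hl2 := Real.log_two_lt_d9
  have hl2' := Real.log_two_gt_d9
  have hl3 := Real.log_three_gt_d9
  -- reduce to a statement about the bracket
  have hkey : (0.67 : ℝ) / 4 < Real.log 2 +
      2 * (∫ u in (3 : ℝ)..4, (5 / 2 - u) / (u * (5 - u)) * linearSieveJ (u - 1)) -
        switchingConstantTenth := by
    norm_num at hl2 hl2' hl3 hc ⊢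
    linarith
  have e : Real.exp Real.eulerMascheroniConstant / 5 *
        (Real.log 2 + 2 * ∫ u in (3 : ℝ)..4, (5 / 2 - u) / (u * (5 - u)) * linearSieveJ (u - 1)) -
      2 * Real.exp Real.eulerMascheroniConstant / 5 * switchingConstantTenth / 2 =
      Real.exp Real.eulerMascheroniConstant / 5 *
        (Real.log 2 + 2 * (∫ u in (3 : ℝ)..4, (5 / 2 - u) / (u * (5 - u)) * linearSieveJ (u - 1)) -
          switchingConstantTenth) := by ring
  rw [e]
  have e2 : 0.67 * Real.exp Real.eulerMascheroniConstant / 20 =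
      Real.exp Real.eulerMascheroniConstant / 5 * ((0.67 : ℝ) / 4) := by ring
  rw [e2]
  exact mul_lt_mul_of_pos_left hkey (by positivity)

end Literature.NumberTheory.Sieve.Chen
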